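import Mathlib.RingTheory.Spectrum.Prime.FreeLocus
import Mathlib.RingTheory.Spectrum.Prime.Chevalley
import Mathlib.RingTheory.Flat.Localization
import Mathlib.RingTheory.Localization.Away.AdjoinRoot
import Mathlib.RingTheory.Localization.InvSubmonoid
import Literature.RingTheory.KrullDimension.FibreDimension
import HarnessLib

/-!
# Generic flatness (weak form) and generic openness of a dominant morphism of affine varieties

Standard commutative algebra behind Springer, *Linear Algebraic Groups* (2nd ed.), Thm. 5.1.6 (i)
("*Let `X` and `Y` be irreducible varieties and let `φ : X → Y` be a dominant morphism. … There
is a non-empty open subset `U` of `X` … (i) The restriction of `φ` to `U` is an open morphism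
`U → Y`*") in the affine and purely algebraic form, continuing `FibreDimension.lean` (relative
Noether normalisation). Namespace `Literature.RingTheory.KrullDimension`. Main results, for
finitely generated algebras `A → B` over a Noetherian domain / a field with `B` a domain and
`A → B` injective (`Spec B → Spec A` dominant):

* `exists_projective_localizedModule_away` — **generic freeness** for a finite module `M` over a
  Noetherian domain `C`: `M[1/g]` is projective over `C[1/g]` for some `g ≠ 0` (the open free
  locus, Mathlib `Module.isOpen_freeLocus`, contains the generic point);
* `exists_flat_away` (with `finitePresentation_away`) — **generic flatness, weak form**: there
  is `f ≠ 0` in `B` such that the localisation `B[1/f]` is flat (and of finite presentation)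
  over `A` (relative Noether normalisation `A ⊆ A[t₁, …, t_r] ⊆ B`, common denominator `s ∈ A`
  making `B[1/s]` finite over `A[t][1/s]`, generic freeness over `A[t][1/s]`, and flatness of
  polynomial rings and localisations);
* `exists_isOpen_image_comap_of_subset_basicOpen` — **generic openness** (Springer 5.1.6 (i) for
  affine varieties, EGA IV 6.9.1 / Stacks 00I1 + 051R in spirit): there is `f ≠ 0` in `B` such
  that `Spec B → Spec A` maps open subsets of `D(f)` to open subsets of `Spec A` (Mathlib:
  flat + finitely presented ⇒ open, `PrimeSpectrum.isOpenMap_comap_of_hasGoingDown_of_finitePresentation`).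

Not here: the strong form of generic flatness (flatness over a dense open of `Spec A`,
Grothendieck EGA IV 6.9.1), generic freeness of algebras (EGA IV 6.9.2).

## Mathlib

Used: `Module.freeLocus`, `Module.isOpen_freeLocus`, `Module.basicOpen_subset_freeLocus_iff`
(generic freeness of finitely presented modules), `Module.Flat.trans`, `IsLocalization.flat`,
`Algebra.HasGoingDown.of_flat`, `PrimeSpectrum.isOpenMap_comap_of_hasGoingDown_of_finitePresentation`,
`PrimeSpectrum.localization_away_isOpenEmbedding`, `IsLocalization.Away.mul_of_associated`,
`exists_algebraicIndependent_isIntegral_smul` (`FibreDimension.lean`). Mathlib (this pin) has no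
generic flatness / generic freeness for algebras (searched `generic`, `GenericFlat`,
`exists_flat`).

## References

* T. A. Springer, *Linear Algebraic Groups*, 2nd ed., Progress in Mathematics 9, Birkhäuser
  (1998), 5.1.6 (i) [SpringerLAG1998].
* A. Grothendieck, EGA IV₂, 6.9.1; The Stacks Project, Tags 051R, 00I1.
-/

noncomputable section

open PrimeSpectrum

namespace Literature.RingTheory.KrullDimension

/-! ### Generic freeness of a finite module over a Noetherian domain -/

section GenericFreeness

variable (C M : Type*) [CommRing C] [IsDomain C] [IsNoetherianRing C] [AddCommGroup M] [Module C M]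
  [Module.Finite C M]

/-- **Generic freeness** (Grothendieck, EGA IV 6.9.2 for modules; Mathlib's open free locus): a
finite module `M` over a Noetherian domain `C` becomes projective (indeed free) over `C[1/g]` for
some `g ≠ 0` — the free locus of the finitely presented module `M` is open and contains the
generic point, where `M ⊗ Frac C` is a vector space. [folklore] -/
theorem exists_projective_localizedModule_away :
    ∃ g : C, g ≠ 0 ∧ Module.Projective (Localization.Away g) (LocalizedModule.Away g M) := by
  haveI : Module.FinitePresentation C M := Module.finitePresentation_of_finite C M
  let ξ : PrimeSpectrum C := ⟨⊥, Ideal.isPrime_bot⟩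
  have hξfree : ξ ∈ Module.freeLocus C M := by
    rw [Module.mem_freeLocus]
    haveI : IsLocalization (nonZeroDivisors C) (Localization.AtPrime (⊥ : Ideal C)) := by
      rw [← Ideal.primeCompl_bot]
      infer_instance
    letI : Field (Localization.AtPrime (⊥ : Ideal C)) := IsFractionRing.toField C
    change Module.Free (Localization.AtPrime (⊥ : Ideal C))
      (LocalizedModule (⊥ : Ideal C).primeCompl M)
    exact Module.Free.of_divisionRing _ _
  obtain ⟨_, ⟨g, rfl⟩, hξg, hgsub⟩ :=
    PrimeSpectrum.isTopologicalBasis_basic_opens.exists_subset_of_mem_open hξfree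
      Module.isOpen_freeLocus
  refine ⟨g, fun hg0 => ?_, Module.basicOpen_subset_freeLocus_iff.mp hgsub⟩
  rw [SetLike.mem_coe, PrimeSpectrum.mem_basicOpen] at hξg
  exact hξg (show g ∈ (⊥ : Ideal C) from hg0.symm ▸ Submodule.zero_mem _)

end GenericFreeness

/-! ### Generic flatness, weak form -/

section GenericFlatness

variable {A B : Type*} [CommRing A] [IsDomain A] [IsNoetherianRing A] [CommRing B] [IsDomain B]
  [Algebra A B] [FaithfulSMul A B] [Algebra.FiniteType A B]

open MvPolynomial in
/-- **Generic flatness, weak form** (the algebra behind Springer 5.1.6 (i); EGA IV 6.9.1 weak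
form): if `B ⊇ A` are domains with `A` Noetherian and `B` of finite type over `A`, then some
localisation `B[1/f]`, `f ≠ 0`, is flat over `A`. Proof: relative Noether normalisation
`A ⊆ A[t₁,…,t_r] ⊆ B` with a common denominator `s ∈ A` making `B[1/s]` integral, hence finite,
over `A[t][1/s]`; generic freeness (`exists_projective_localizedModule_away`) gives `g ≠ 0` in
`A[t][1/s]` with `B[1/s][1/g]` projective over `A[t][1/s][1/g]`, which is flat over `A`
(polynomial rings and localisations are flat); finally `B[1/s][1/g] = B[1/f]` for `f = s z`,
`g = z / sⁿ`. [cite: SpringerLAG1998, Thm 5.1.6 (i) (proof)] -/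
theorem exists_flat_away : ∃ f : B, f ≠ 0 ∧ Module.Flat A (Localization.Away f) := by
  classical
  have hAB : Function.Injective (algebraMap A B) := FaithfulSMul.algebraMap_injective A B
  -- Step 1: relative Noether normalisation and a common denominator `d`
  obtain ⟨r, t, htinj, htint⟩ := exists_algebraicIndependent_isIntegral_smul (A := A) (B := B)
  obtain ⟨G, hG⟩ := (inferInstance : Algebra.FiniteType A B).out
  choose a ha0 haint using htint
  set d : A := ∏ x ∈ G, a x with hd
  have hd0 : d ≠ 0 := Finset.prod_ne_zero_iff.2 fun x _ => ha0 x
  -- the polynomial ring `P = A[X₁, …, X_r]` acting on `B` through `t`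
  letI algPB : Algebra (MvPolynomial (Fin r) A) B := (MvPolynomial.aeval t).toRingHom.toAlgebra
  haveI : IsScalarTower A (MvPolynomial (Fin r) A) B :=
    IsScalarTower.of_algebraMap_eq fun x => (MvPolynomial.algHom_C (MvPolynomial.aeval t) x).symm
  have hPBinj : Function.Injective (algebraMap (MvPolynomial (Fin r) A) B) := htinj
  -- Step 2: localise at `s = C d`
  set sP : MvPolynomial (Fin r) A := MvPolynomial.C d with hsP
  have hsP0 : sP ≠ 0 := by rw [hsP, Ne, MvPolynomial.C_eq_zero]; exact hd0
  have hM : Submonoid.powers sP ≤ nonZeroDivisors (MvPolynomial (Fin r) A) :=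
    powers_le_nonZeroDivisors_of_noZeroDivisors hsP0
  have hsB : algebraMap (MvPolynomial (Fin r) A) B sP = algebraMap A B d :=
    (IsScalarTower.algebraMap_apply A (MvPolynomial (Fin r) A) B d).symm
  have hsB0 : algebraMap (MvPolynomial (Fin r) A) B sP ≠ 0 := by
    rw [hsB]; exact fun h => hd0 ((map_eq_zero_iff _ hAB).1 h)
  have hN : Algebra.algebraMapSubmonoid B (Submonoid.powers sP) =
      Submonoid.powers (algebraMap (MvPolynomial (Fin r) A) B sP) := Submonoid.map_powers _ _
  have hN' : Algebra.algebraMapSubmonoid B (Submonoid.powers sP) ≤ nonZeroDivisors B := by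
    rw [hN]; exact powers_le_nonZeroDivisors_of_noZeroDivisors hsB0
  -- notation for the two localisations
  set Ps := Localization.Away sP with hPs
  set Bs := Localization (Algebra.algebraMapSubmonoid B (Submonoid.powers sP)) with hBs
  haveI : IsDomain Bs := IsLocalization.isDomain_of_le_nonZeroDivisors _ hN'
  haveI hBsaway : IsLocalization.Away (algebraMap (MvPolynomial (Fin r) A) B sP) Bs := by
    change IsLocalization _ _
    rw [← hN]
    infer_instance
  haveI : IsDomain Ps := IsLocalization.isDomain_of_le_nonZeroDivisors _ hM
  haveI : IsNoetherianRing Ps := IsLocalization.isNoetherianRing (Submonoid.powers sP) Ps inferInstance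
  -- `Ps → Bs` is injective
  have halgmap : algebraMap Ps Bs = IsLocalization.map Bs (algebraMap (MvPolynomial (Fin r) A) B)
      ((Submonoid.powers sP).le_comap_map) :=
    IsLocalization.algebraMap_eq_map_map_submonoid (Submonoid.powers sP) B Ps Bs
  haveI : IsLocalization ((Submonoid.powers sP).map (algebraMap (MvPolynomial (Fin r) A) B)) Bs :=
    inferInstanceAs (IsLocalization (Algebra.algebraMapSubmonoid B (Submonoid.powers sP)) Bs)
  have hinj' : Function.Injective (algebraMap Ps Bs) := by
    rw [halgmap]
    exact IsLocalization.map_injective_of_injective (Submonoid.powers sP) Ps Bs hPBinj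
  -- scalar towers
  haveI : IsScalarTower A Ps Bs := IsScalarTower.of_algebraMap_eq fun x => by
    rw [IsScalarTower.algebraMap_apply A (MvPolynomial (Fin r) A) Ps,
      ← IsScalarTower.algebraMap_apply (MvPolynomial (Fin r) A) Ps Bs,
      IsScalarTower.algebraMap_apply (MvPolynomial (Fin r) A) B Bs,
      IsScalarTower.algebraMap_apply A B Bs, ← IsScalarTower.algebraMap_apply A (MvPolynomial (Fin r) A) B]
  -- the inverse `w` of `s` in `Bs`
  set w : Bs := algebraMap Ps Bs (IsLocalization.mk' Ps (1 : MvPolynomial (Fin r) A)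
    ⟨sP, Submonoid.mem_powers _⟩) with hwdef
  have hw : algebraMap (MvPolynomial (Fin r) A) Bs sP * w = 1 := by
    rw [hwdef, IsScalarTower.algebraMap_apply (MvPolynomial (Fin r) A) Ps Bs, ← map_mul, mul_comm,
      IsLocalization.mk'_spec, map_one, map_one]
  have hwint : IsIntegral Ps w := isIntegral_algebraMap
  -- Step 3: every element of `B` becomes integral over `Ps`
  let T : Subalgebra A B :=
    { carrier := {b | IsIntegral Ps (algebraMap B Bs b)}
      mul_mem' := fun {x y} hx hy => by
        simp only [Set.mem_setOf_eq, map_mul] at hx hy ⊢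
        exact hx.mul hy
      add_mem' := fun {x y} hx hy => by
        simp only [Set.mem_setOf_eq, map_add] at hx hy ⊢
        exact hx.add hy
      algebraMap_mem' := fun x => by
        change IsIntegral Ps (algebraMap B Bs (algebraMap A B x))
        rw [← IsScalarTower.algebraMap_apply A B Bs, IsScalarTower.algebraMap_apply A Ps Bs]
        exact isIntegral_algebraMap }
  have hGT : (G : Set B) ⊆ T := by
    intro x hx
    change IsIntegral Ps (algebraMap B Bs x)
    have h1 : IsIntegral (MvPolynomial (Fin r) A) (d • x) := by
      have h2 : d • x = (∏ y ∈ G.erase x, a y) • (a x • x) := by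
        rw [smul_smul, Finset.prod_erase_mul _ _ hx]
      rw [h2, Algebra.smul_def, IsScalarTower.algebraMap_apply A (MvPolynomial (Fin r) A) B]
      exact isIntegral_algebraMap.mul (haint x)
    have h4 : IsIntegral Ps (algebraMap B Bs (d • x)) := h1.algebraMap.tower_top
    have h5 : algebraMap B Bs x = algebraMap B Bs (d • x) * w := by
      rw [Algebra.smul_def, ← hsB, map_mul,
        ← IsScalarTower.algebraMap_apply (MvPolynomial (Fin r) A) B Bs, mul_right_comm, hw, one_mul]
    rw [h5]
    exact h4.mul hwint
  have hT : T = ⊤ := top_le_iff.1 (hG ▸ Algebra.adjoin_le hGT)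
  have hBint : ∀ b : B, IsIntegral Ps (algebraMap B Bs b) := fun b =>
    show b ∈ T by rw [hT]; exact Algebra.mem_top
  haveI hBsint : Algebra.IsIntegral Ps Bs := ⟨fun z => by
    obtain ⟨⟨b, y⟩, hby⟩ := IsLocalization.surj (Algebra.algebraMapSubmonoid B (Submonoid.powers sP)) z
    obtain ⟨y₀, ⟨n, hn⟩, hy₀⟩ := (Submonoid.mem_map).1 y.2
    simp only at hby
    have hz : z = algebraMap B Bs b * w ^ n := by
      have h1 : algebraMap B Bs (y : B) = algebraMap (MvPolynomial (Fin r) A) Bs sP ^ n := by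
        rw [← hy₀, ← hn, map_pow, map_pow, IsScalarTower.algebraMap_apply (MvPolynomial (Fin r) A) B Bs]
      calc z = z * (algebraMap (MvPolynomial (Fin r) A) Bs sP * w) ^ n := by rw [hw, one_pow, mul_one]
        _ = z * algebraMap B Bs (y : B) * w ^ n := by rw [mul_pow, h1, mul_assoc]
        _ = _ := by rw [hby]
    rw [hz]
    exact (hBint b).mul (hwint.pow n)⟩
  -- hence `Bs` is a finite `Ps`-module
  haveI : Algebra.FinitePresentation B Bs :=
    IsLocalization.Away.finitePresentation (algebraMap (MvPolynomial (Fin r) A) B sP)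
  haveI : Algebra.FiniteType B Bs := inferInstance
  haveI : Algebra.FiniteType A Bs := Algebra.FiniteType.trans (S := B) inferInstance inferInstance
  haveI : Algebra.FiniteType Ps Bs := Algebra.FiniteType.of_restrictScalars_finiteType A Ps Bs
  haveI : Module.Finite Ps Bs := Algebra.IsIntegral.finite
  -- Step 4: generic freeness over `Ps`
  obtain ⟨g, hg0, hproj⟩ := exists_projective_localizedModule_away Ps Bs
  set L := Localization.Away g with hL
  set Tg := Localization (Algebra.algebraMapSubmonoid Bs (Submonoid.powers g)) with hTg
  have hNg : Algebra.algebraMapSubmonoid Bs (Submonoid.powers g) =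
      Submonoid.powers (algebraMap Ps Bs g) := Submonoid.map_powers _ _
  haveI hTgaway : IsLocalization.Away (algebraMap Ps Bs g) Tg := by
    change IsLocalization _ _
    rw [← hNg]
    infer_instance
  -- `Tg` is projective, hence flat, over `L = Ps[1/g]`
  haveI : Module.Flat L Tg := by
    let e₀ : LocalizedModule (Submonoid.powers g) Bs ≃ₗ[Ps] Tg :=
      IsLocalizedModule.iso (Submonoid.powers g) (IsScalarTower.toAlgHom Ps Bs Tg).toLinearMap
    let e : LocalizedModule.Away g Bs ≃ₗ[L] Tg := e₀.extendScalarsOfIsLocalization (Submonoid.powers g) L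
    haveI : Module.Projective L Tg := Module.Projective.of_equiv e
    infer_instance
  -- flatness down to `A`
  haveI : Module.Flat Ps L := IsLocalization.flat L (Submonoid.powers g)
  haveI : Module.Flat Ps Tg := Module.Flat.trans Ps L Tg
  haveI : Module.Flat (MvPolynomial (Fin r) A) Ps := IsLocalization.flat Ps (Submonoid.powers sP)
  haveI : Module.Flat (MvPolynomial (Fin r) A) Tg := Module.Flat.trans (MvPolynomial (Fin r) A) Ps Tg
  haveI : Module.Flat A Tg := Module.Flat.trans A (MvPolynomial (Fin r) A) Tg
  -- Step 5: `Tg = B[1/f]` with `f = s z`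
  obtain ⟨⟨z, u⟩, hzu⟩ := IsLocalization.surj (Submonoid.powers (algebraMap (MvPolynomial (Fin r) A) B sP))
    (algebraMap Ps Bs g)
  simp only at hzu
  have hassoc : Associated (algebraMap B Bs z) (algebraMap Ps Bs g) := by
    refine (Associated.symm ⟨IsUnit.unit (IsLocalization.map_units Bs u), ?_⟩)
    rw [IsUnit.unit_spec]
    exact hzu
  haveI : IsLocalization.Away (algebraMap (MvPolynomial (Fin r) A) B sP * z) Tg :=
    IsLocalization.Away.mul_of_associated _ z (algebraMap Ps Bs g) hassoc
  set f : B := algebraMap (MvPolynomial (Fin r) A) B sP * z with hf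
  have hz0 : z ≠ 0 := by
    intro hz
    rw [hz, map_zero] at hzu
    have hg' : algebraMap Ps Bs g = 0 :=
      (IsUnit.mul_left_eq_zero (IsLocalization.map_units Bs u)).1 hzu
    exact hg0 (hinj' (by rw [hg', map_zero]))
  have hf0 : f ≠ 0 := mul_ne_zero hsB0 hz0
  refine ⟨f, hf0, ?_⟩
  -- transport flatness along `Tg ≃ₐ[B] B[1/f]`
  let e' : Tg ≃ₐ[B] Localization.Away f :=
    IsLocalization.algEquiv (Submonoid.powers f) Tg (Localization.Away f)
  exact Module.Flat.of_linearEquiv (e'.toLinearEquiv.restrictScalars A).symm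

omit [IsDomain A] [IsDomain B] [FaithfulSMul A B] in
/-- A localisation `B[1/f]` of a finite type algebra over a Noetherian ring is of finite
presentation. [folklore] -/
theorem finitePresentation_away (f : B) : Algebra.FinitePresentation A (Localization.Away f) := by
  haveI : Algebra.FiniteType B (Localization.Away f) :=
    IsLocalization.finiteType_of_monoid_fg (Submonoid.powers f) _
  haveI : Algebra.FiniteType A (Localization.Away f) :=
    Algebra.FiniteType.trans (S := B) inferInstance inferInstance
  exact (Algebra.FinitePresentation.of_finiteType).mp inferInstance

/-- **Generic openness** (Springer 5.1.6 (i) for a dominant morphism `Spec B → Spec A` of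
affine varieties, `A ⊆ B` domains of finite type over a Noetherian domain): there is `f ≠ 0` in
`B` such that `Spec B → Spec A` maps every open subset of the basic open set `D(f)` onto an open
subset of `Spec A` — by generic flatness (`exists_flat_away`) and the openness of flat finitely
presented morphisms (Mathlib `PrimeSpectrum.isOpenMap_comap_of_hasGoingDown_of_finitePresentation`,
Stacks 00I1). [cite: SpringerLAG1998, Thm 5.1.6 (i)] -/
theorem exists_isOpen_image_comap_of_subset_basicOpen :
    ∃ f : B, f ≠ 0 ∧ ∀ U : Set (PrimeSpectrum B), IsOpen U →
      U ⊆ (PrimeSpectrum.basicOpen f : Set (PrimeSpectrum B)) →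
      IsOpen (PrimeSpectrum.comap (algebraMap A B) '' U) := by
  obtain ⟨f, hf0, hflat⟩ := exists_flat_away (A := A) (B := B)
  haveI := hflat
  haveI := finitePresentation_away (A := A) (B := B) f
  refine ⟨f, hf0, fun U hU hUf => ?_⟩
  set ι : PrimeSpectrum (Localization.Away f) → PrimeSpectrum B :=
    PrimeSpectrum.comap (algebraMap B (Localization.Away f)) with hι
  have hιemb : Topology.IsOpenEmbedding ι := PrimeSpectrum.localization_away_isOpenEmbedding _ f
  have hrange : Set.range ι = (PrimeSpectrum.basicOpen f : Set (PrimeSpectrum B)) :=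
    PrimeSpectrum.localization_away_comap_range _ f
  have hU' : U = ι '' (ι ⁻¹' U) := by
    rw [Set.image_preimage_eq_inter_range, hrange, Set.inter_eq_left.2 hUf]
  have hcomp : PrimeSpectrum.comap (algebraMap A B) ∘ ι =
      PrimeSpectrum.comap (algebraMap A (Localization.Away f)) := by
    funext p
    rw [Function.comp_apply, hι, ← PrimeSpectrum.comap_comp_apply, ← IsScalarTower.algebraMap_eq]
  rw [hU', ← Set.image_comp, hcomp]
  exact PrimeSpectrum.isOpenMap_comap_of_hasGoingDown_of_finitePresentation _
    (hU.preimage hιemb.continuous)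

end GenericFlatness

end Literature.RingTheory.KrullDimension
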